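import Summits.BirchSwinnertonDyer.Rank1Residual.X11b.RouteR1IntReceptacle
import Summits.BirchSwinnertonDyer.Rank1Residual.X11b.AnticyclotomicSelmerDual
import Literature.NumberTheory.EllipticCurves.IwasawaSelmerProofs
import HarnessLib

/-!
# Route `AdditiveBranchIMC` (rung K1), cruxes 19357 / 19358 / 19359, stub `stub_tameAwayFromCyc{R0,M}` (skeleton v22):
# the anticyclotomic one-variable objects of the tame road do NOT see the choice of the topological generator
# `γ` inside its class modulo `ker κ` (route (β) of `LeadReport14.md` §6)

Cell `bsd-addord`, LEAD seat `cruxlead-19357` (gen 7). THEOREMS ONLY (no definition, no named fact, no `sorry`). If the printed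
two-variable divisibility (Castella–Liu–Wan 2022 Thm. 8.2.1 (1)) is typed at ADAPTED generator pairs `(κ_cyc, κ; γ₁, γ₂)`
(`γ₂ ∈ ker κ_cyc`), while the tame lines' one-variable chain fixes an ARBITRARY topological generator `γ` of `κ` (`κ γ = 1`), the
glue runs the specialisation `TameSpecialization.S2L` at `γ₂` and transports the ONE-variable objects from `γ₂` to `γ`; this file
proves that transport — they are literally EQUAL, because `γ⁻¹γ₂ ∈ ker κ = Gal(K̄/K_∞)` acts trivially on `H¹(K_∞, E[p^∞])`:

* `avatarValueAt_eq_of_apply_eq`, `isBDPLFunctionInt_iff_of_apply_eq` — a ♭-frame at `(κ, γ)` is a ♭-frame at `(κ, γ₂)` when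
  `κ γ = κ γ₂` (the avatars factor through `κ`);
* `conjSelmerAc_eq_of_apply_eq` — `conj_γ = conj_{γ₂}` on `Sel_𝔭^Σ(K_∞, E[p^∞])` (`conjH1_mul`, `conjH1_of_mem`);
* `instModuleXAc_eq_of_apply_eq`, `charIdeal_eq_of_apply_eq`, `isTorsion_iff_of_apply_eq` — hence the `Λ`-module structures of
  `X_ac^Σ` at `γ` and at `γ₂` COINCIDE, and so do `Ch_Λ(X_ac^Σ)` and `Λ`-torsion-ness.

References: R. Greenberg, LNM 1716 (1999) §1 p. 60 (the choice of a topological generator); J.-P. Serre, *Local Fields* VII §5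
Prop. 3 (inner automorphisms act trivially on cohomology); F. Castella, Camb. J. Math. 6 (2018) §2.2, Thm. 3.1.
-/

set_option linter.dupNamespace false
set_option autoImplicit false

noncomputable section

open scoped Classical

open NumberField IsDedekindDomain Field
  Literature.NumberTheory.EllipticCurves Literature.NumberTheory.GaloisRepresentations
  Summit.BirchSwinnertonDyer.Rank1Residual.X11b

namespace Summit.BirchSwinnertonDyer.BirchSwinnertonDyer.Theorems.TameGeneratorChange

variable {K : Type} [Field K] [NumberField K] {p : ℕ} [Fact p.Prime]

/-! ### §1 ♭-frames -/

omit [NumberField K] in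
/-- A character of `Γ_K` through `κ` takes the same value at `γ` and `γ₂` when `κ γ = κ γ₂` (`γ⁻¹γ₂ ∈ ker κ`).
[cite: Castella2018, Thm. 3.1 (arXiv:1704.06608 p. 9)] -/
theorem avatarValueAt_eq_of_apply_eq (κ : ZpExtension K p) {γ γ₂ : absoluteGaloisGroup K} (hκ : κ γ = κ γ₂)
    {r : FramedGaloisRep K (PadicAlgCl p) 1} (hr : FactorsThroughZp κ r) :
    avatarValueAt r γ = avatarValueAt r γ₂ := by
  have hmem : κ (γ⁻¹ * γ₂) = 1 := by rw [map_mul, map_inv, hκ, inv_mul_cancel]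
  have h1 : r (γ⁻¹ * γ₂) = 1 := hr _ hmem
  have h2 : r γ₂ = r γ := by
    have : γ₂ = γ * (γ⁻¹ * γ₂) := by group
    rw [this, map_mul, h1, mul_one]
  unfold avatarValueAt
  rw [h2]

/-- **A ♭-frame at `(κ, γ)` is a ♭-frame at `(κ, γ₂)`** when `κ γ = κ γ₂`: Castella's interpolation property reads the values at
`φ̂(γ) − 1 = φ̂(γ₂) − 1`. [cite: Castella2018, Thm. 3.1 (arXiv:1704.06608 p. 9)] -/
theorem isBDPLFunctionInt_iff_of_apply_eq {N : ℕ} (ι : PadicAlgCl p ≃+* ℂ) (𝔭 : HeightOneSpectrum (𝓞 K))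
    (κ : ZpExtension K p) {γ γ₂ : absoluteGaloisGroup K} (hκ : κ γ = κ γ₂)
    (f : CuspForm (CongruenceSubgroup.Gamma0 N) 2) (ΩK : ℂ) (Ωp : ℂ_[p]) (Q : PowerSeries 𝓞_ℂ_[p]) :
    R1.IsBDPLFunctionInt p ι 𝔭 κ γ f ΩK Ωp Q ↔ R1.IsBDPLFunctionInt p ι 𝔭 κ γ₂ f ΩK Ωp Q := by
  unfold R1.IsBDPLFunctionInt
  refine forall_congr' fun φ ↦ forall_congr' fun n ↦ forall_congr' fun _ ↦ forall_congr' fun _ ↦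
    forall_congr' fun _ ↦ forall_congr' fun r ↦ forall_congr' fun _ ↦ forall_congr' fun hr ↦ ?_
  rw [avatarValueAt_eq_of_apply_eq κ hκ hr]

/-! ### §2 The `Λ`-structure of `X_ac^Σ` -/

section XAc

variable (W : WeierstrassCurve K) (κ : ZpExtension K p) (𝔭 : HeightOneSpectrum (𝓞 K))
  (S : Set (HeightOneSpectrum (𝓞 K)))

/-- **`conj_γ = conj_{γ₂}` on `Sel_𝔭^Σ(K_∞, E[p^∞])`** when `κ γ = κ γ₂`: `γ₂ = γ·(γ⁻¹γ₂)` with `γ⁻¹γ₂ ∈ ker κ = Gal(K̄/K_∞)`,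
which acts trivially on `H¹(K_∞, ·)` (`conjH1_mul`, `conjH1_of_mem`). [cite: SerreLocalFields1979, VII §5 Prop. 3] -/
theorem conjSelmerAc_eq_of_apply_eq {γ γ₂ : absoluteGaloisGroup K} (hκ : κ γ = κ γ₂) :
    AcSelmer.conjSelmerAc W p κ 𝔭 S γ = AcSelmer.conjSelmerAc W p κ 𝔭 S γ₂ := by
  have hmem : γ⁻¹ * γ₂ ∈ κ.kerSubgroup := by
    rw [ZpExtension.mem_kerSubgroup, map_mul, map_inv, hκ, inv_mul_cancel]
  have hconj : W.conjH1 p κ.kerSubgroup γ₂ = W.conjH1 p κ.kerSubgroup γ := by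
    have : γ₂ = γ * (γ⁻¹ * γ₂) := by group
    rw [this, W.conjH1_mul_holds p κ.kerSubgroup, W.conjH1_of_mem_holds p κ.kerSubgroup hmem,
      AddMonoidHom.comp_id]
  refine DFunLike.ext _ _ fun s ↦ Subtype.ext ?_
  have h1 := AcSelmer.coe_conjSelmerAc_apply W p κ 𝔭 S γ s
  have h2 := AcSelmer.coe_conjSelmerAc_apply W p κ 𝔭 S γ₂ s
  rw [hconj] at h2
  exact h1.trans h2.symm

/-- Two `IsLocNil.module` structures attached to EQUAL endomorphisms are equal (proof irrelevance). [folklore]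
[cite: GreenbergLNM1716, §1 (after Conj. 1.3)] -/
theorem isLocNil_module_congr {T : Type*} [AddCommGroup T] {A : Type*} [AddCommGroup A] {ψ₁ ψ₂ : AddMonoid.End T}
    (e : ψ₁ = ψ₂) (h₁ : IwasawaDual.IsLocNil p ψ₁) (h₂ : IwasawaDual.IsLocNil p ψ₂) :
    (h₁.module : Module (PowerSeries ℤ_[p]) (T →+ A)) = h₂.module := by
  subst e
  rfl

/-- **The `Λ`-module structures of `X_ac^Σ` at `γ` and at `γ₂` coincide** when `κ γ = κ γ₂` (both are `IsLocNil.module` of the SAME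
endomorphism `conj − 1`). [cite: GreenbergLNM1716, §1 p. 60] -/
theorem instModuleXAc_eq_of_apply_eq {γ γ₂ : absoluteGaloisGroup K} [hγ : Fact (κ.IsTopGenerator γ)]
    [hγ₂ : Fact (κ.IsTopGenerator γ₂)] (hκ : κ γ = κ γ₂) :
    AcSelmer.instModuleXAc W p κ 𝔭 S γ = AcSelmer.instModuleXAc W p κ 𝔭 S γ₂ := by
  unfold AcSelmer.instModuleXAc
  exact isLocNil_module_congr (by rw [conjSelmerAc_eq_of_apply_eq W κ 𝔭 S hκ]) _ _

/-- **`Ch_Λ(X_ac^Σ)` does not depend on the generator inside its class**: `κ γ = κ γ₂ ⟹` the characteristic ideals at `γ` and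
`γ₂` are EQUAL. [cite: GreenbergLNM1716, §1 p. 60] [cite: Castella2018, Thm. 2.3 (arXiv:1704.06608 p. 5)] -/
theorem charIdeal_eq_of_apply_eq {γ γ₂ : absoluteGaloisGroup K} [hγ : Fact (κ.IsTopGenerator γ)]
    [hγ₂ : Fact (κ.IsTopGenerator γ₂)] (hκ : κ γ = κ γ₂) :
    AcSelmer.XAc.charIdeal W p κ 𝔭 S γ = AcSelmer.XAc.charIdeal W p κ 𝔭 S γ₂ := by
  unfold AcSelmer.XAc.charIdeal
  change @Module.charIdeal (IwasawaAlgebra p) _ (AcSelmer.XAc W p κ 𝔭 S γ) _ (AcSelmer.instModuleXAc W p κ 𝔭 S γ) =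
    @Module.charIdeal (IwasawaAlgebra p) _ (AcSelmer.XAc W p κ 𝔭 S γ) _ (AcSelmer.instModuleXAc W p κ 𝔭 S γ₂)
  rw [instModuleXAc_eq_of_apply_eq W κ 𝔭 S hκ]

/-- **`Λ`-torsion-ness of `X_ac^Σ` does not depend on the generator inside its class.** [cite: GreenbergLNM1716, §1 p. 60] -/
theorem isTorsion_iff_of_apply_eq {γ γ₂ : absoluteGaloisGroup K} [hγ : Fact (κ.IsTopGenerator γ)]
    [hγ₂ : Fact (κ.IsTopGenerator γ₂)] (hκ : κ γ = κ γ₂) :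
    Module.IsTorsion (IwasawaAlgebra p) (AcSelmer.XAc W p κ 𝔭 S γ) ↔
      Module.IsTorsion (IwasawaAlgebra p) (AcSelmer.XAc W p κ 𝔭 S γ₂) := by
  change @Module.IsTorsion (IwasawaAlgebra p) (AcSelmer.XAc W p κ 𝔭 S γ) _ _ (AcSelmer.instModuleXAc W p κ 𝔭 S γ) ↔
    @Module.IsTorsion (IwasawaAlgebra p) (AcSelmer.XAc W p κ 𝔭 S γ) _ _ (AcSelmer.instModuleXAc W p κ 𝔭 S γ₂)
  rw [instModuleXAc_eq_of_apply_eq W κ 𝔭 S hκ]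
  exact Iff.rfl

end XAc

end Summit.BirchSwinnertonDyer.BirchSwinnertonDyer.Theorems.TameGeneratorChange

end
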